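import Mathlib.Analysis.Convex.SpecificFunctions.Basic
import Literature.Probability.Percolation.OneArmFromNeumann
import HarnessLib

/-!
# LSW's comparison (2.17) with one-sided boundary conditions at `θ = 2π` (proofs only)

Topic `Probability/Percolation`; theorems only, a sequel of `OneArmMaximumPrinciple`,
`OneArmComparisonExplicit`, `OneArmRenewal` and `OneArmScalingLimitFromNeumann`. In the proof
of Theorem 1.2 of Lawler–Schramm–Werner, *One-arm exponent for critical 2D percolation*,
Electron. J. Probab. **7** (2002), paper no. 2 (pp. 7–8), the Neumann condition (2.12)
`∂_θ h̃(2π, t) = 0` of Lemma 2.3 enters only through the maximum-principle step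

> "Observe also that `θ₀ ≠ 2π`, because `∂_θ F > 0` at `θ = 2π`"

for `F = G + ε θ^{q/2} + ε`, `G = h̃ - cH` or `G = c'H - h̃`. For that step much less than
(2.12) is needed, and the two halves of (2.17) `cH ≤ h̃ ≤ c'H` need DIFFERENT halves of it:

* the **lower bound `cH ≤ h̃`** (hence `h(2π, t) ≥ c e^{-λt}`, i.e. the one-arm probability
  is AT LEAST `≍ r^{5/48}`) needs only **`h̃(θ, t) ≤ h̃(2π, t)` for `θ < 2π`** — for LSW's
  hitting function this is the monotonicity `Q(θ) ⊆ Q(2π) ⟹ 𝔯(2π) ≤ 𝔯(θ)` of the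
  percolation sets in the arc, no estimate at all;
* the **upper bound `h̃ ≤ c'H`** needs only the **one-sided Dini condition
  `liminf_{θ↑2π} (h̃(2π, t) - h̃(θ, t))/(2π - θ) ≤ 0`**, a consequence of (2.12).

This file proves (2.17) and everything downstream of it in the tree under these one-sided
hypotheses, so that after the identification (2.10) of the renewal extension with the arc
hitting function (Smirnov's theorem in the form of LSW's Thm. 2.1 plus radial `SLE₆`, the
content of the named fact `LawlerSchrammWerner2002_hittingPDE`) the LOWER half of Theorem 1.2
and of the one-arm exponent no longer depends on Lemma 2.3 (the half-plane three-arm bound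
(2.13) and the harmonic-measure estimates (2.14)–(2.16)):

* `lsw_maxPrinciple_dini` — LSW's maximum principle (`lsw_maxPrinciple`) with the right-side
  condition weakened to: for every `t` and `η > 0` some `θ ∈ (0, b)` has
  `G(θ, t) < G(b, t) + η (b - θ)` (the perturbation `ε θ^{q/2}` absorbs `η (b - θ)` by
  concavity of `θ^{q/2}`, Bernoulli's inequality `rpow_one_add_le_one_add_mul_self`);
* `lsw_comparison_step3_upper`, `lsw_comparison_step3_lower` — step 3 of p. 8 on
  `[0, 2π] × [1, ∞)` split accordingly (the lower one from `g(θ, t) ≤ g(2π, t)`, the upper one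
  from the Dini condition, `H` having `∂_θ H(2π, t) = 0`);
* `LawlerSchrammWerner2002_comparison_lower`, `LawlerSchrammWerner2002_comparison_upper` —
  (2.17) with the explicit constants of `LawlerSchrammWerner2002_comparison_explicit`, split;
* `LawlerSchrammWerner2002_exp_bounds_oneSided` — THEOREM A of `OneArmRenewal` split: for
  `κ > 4` and antitone data `u : ℝ → [0, 1]` with `u(3) ≥ m₀ > 0`, the renewal extension
  `g = renewalST κ V U` (`U = dataU u`, `V = dataV`) gives `e^{-λt}/c₂ ≤ u(t)` (`t ≥ 1`) as soon
  as `g(θ, t) ≤ U(t)` for `θ ∈ (0, 2π)`, `t > 0`, and `u(t) ≤ c₁ e^{2λ} e^{-λt}` (`t ≥ 3`) as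
  soon as `g(·, t)` satisfies the Dini condition at `2π` for `t > 0`;
* `measure_lower_of_exp_lower`, `measure_upper_of_exp_upper` — the two halves of
  `measure_bounds_of_exp_bounds` (Koebe);
* `exists_measure_lower_of_renewal_le`, `exists_measure_upper_of_renewal_dini` — at
  subsequential weak limits `ν` of `lswLaw`: `C⁻¹ r^{5/48} ≤ ν{dist(0, K) < r}` from the
  monotonicity condition alone, `ν{dist(0, K) ≤ r} ≤ C r^{5/48}` from the Dini condition alone,
  ONE constant `C` for all `ν` (lower bound `u(3) ≥ m₀` from
  `exists_lower_bound_confRad_subseqLimits`);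
* `LawlerSchrammWerner2002_scalingLimitExponent_of_le_of_dini`,
  `oneArm_exponent_of_le_of_dini` — Theorem 1.2 (the named fact
  `LawlerSchrammWerner2002_scalingLimitExponent`) and Theorem 1.1 (`oneArm_exponent`) from the
  two one-sided conditions, refining `…_of_neumannFlat`.

No new definitions, no new named facts.

## References

* G. F. Lawler, O. Schramm, W. Werner, *One-arm exponent for critical 2D percolation*, Electron.
  J. Probab. 7 (2002), no. 2 — Thm. 1.1, Thm. 1.2, §2 (Lemma 2.3, (2.12)), proof of Thm. 1.2
  (pp. 7–8), (2.17) [LawlerSchrammWernerEJP2002].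

## Mathlib / tree

Tree: `lsw_maxPrinciple_strict`, `lsw_comparison_step1_upper`, `lsw_comparison_step1_lower`,
`lswOp_rpow_neg`, `lswH`, `lswHθ_two_pi`, `hasDerivAt_lswH_theta` (`OneArmMaximumPrinciple`);
`renewalST`, `renewalST_two_pi` and its regularity (`RadialBesselRenewal`); `dataU`, `dataV`,
`renewalST_lower`, `measureReal_sleExitsTop_one_pos` (`OneArmRenewal`);
`exists_lower_bound_confRad_subseqLimits`; `crossingBounds_of_subseqLimits`,
`oneArm_exponent_of_crossingBounds`, `BollobasRiordan2006_openCircuit_holds`. Mathlib: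
`rpow_one_add_le_one_add_mul_self` (Bernoulli).
-/

noncomputable section

open MeasureTheory Filter Topology Set TopologicalSpace
open scoped NNReal
open Literature.Probability.LatticeModels
open Literature.Probability.RandomPlanarGeometry Literature.Probability.RandomPlanarGeometry.RadialLoewner
open Literature.Probability.Process Literature.Analysis.FunctionSpaces

namespace Literature.Probability.Percolation

/-! ### The maximum principle with a one-sided Dini condition on the right side -/

section MaxPrinciple

open Real

/-- Concavity of `θ ↦ θ^p`, `0 ≤ p ≤ 1`, at the point `b > 0`: for `θ ≥ 0`,
`p b^{p-1} (b - θ) ≤ b^p - θ^p` (the tangent line at `b` lies above the graph; Bernoulli's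
inequality). [folklore] -/
theorem mul_rpow_sub_one_mul_sub_le {p b θ : ℝ} (hp0 : 0 ≤ p) (hp1 : p ≤ 1) (hb : 0 < b)
    (hθ0 : 0 ≤ θ) : p * b ^ (p - 1) * (b - θ) ≤ b ^ p - θ ^ p := by
  have hs : -1 ≤ θ / b - 1 := by
    have : 0 ≤ θ / b := div_nonneg hθ0 hb.le
    linarith
  have hB := rpow_one_add_le_one_add_mul_self hs hp0 hp1
  have e1 : 1 + (θ / b - 1) = θ / b := by ring
  rw [e1, Real.div_rpow hθ0 hb.le, div_le_iff₀ (Real.rpow_pos_of_pos hb p)] at hB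
  have e2 : b ^ (p - 1) = b ^ p / b := by
    rw [Real.rpow_sub_one hb.ne']
  rw [e2]
  have e3 : p * (b ^ p / b) * (b - θ) = p * b ^ p - p * (θ / b) * b ^ p := by
    field_simp
  rw [e3]
  nlinarith [hB]

/-- **LSW's maximum principle with a one-sided Dini condition on the right side.** As
`lsw_maxPrinciple` (`κ > 4`, `0 < b ≤ 2π`, `G` continuous on `[0, b] × [T₀, T₁]`, `C^{2,1}` on
`(0, b) × (T₀, T₁]` with `Λ G ≤ 0`, `G ≥ 0` on the bottom and left sides), but on the right side
`θ = b` it is only assumed that for every `t ∈ (T₀, T₁]` and every `η > 0` some `θ ∈ (0, b)` has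
`G(θ, t) < G(b, t) + η (b - θ)` (true if `G(·, t) ≤ G(b, t)` somewhere, or if the lower left
Dini derivative of `G(·, t)` at `b` is `< η` for all `η > 0`, in particular under LSW's Neumann
condition). Then `G ≥ 0`. Proof as printed (p. 7): `F = G + ε (θ^{q/2} + 1)` has `Λ F < 0`,
`F ≥ ε` on the bottom and left sides, and if `F(b, t) ≤ 0` then
`F(θ, t) < F(b, t) + η(b - θ) - ε (b^{q/2} - θ^{q/2}) ≤ 0` for the `θ` provided by the
hypothesis with `η = ε (q/2) b^{q/2 - 1}` (concavity); so `lsw_maxPrinciple_strict` applies, and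
`ε → 0`. [cite: LawlerSchrammWernerEJP2002, proof of Thm. 1.2 (pp. 7–8)] -/
theorem lsw_maxPrinciple_dini {κ b T₀ T₁ : ℝ} (hκ : 4 < κ) (hb : 0 < b) (hb' : b ≤ 2 * π)
    {G Gθ Gθθ Gt : ℝ → ℝ → ℝ}
    (hcont : ContinuousOn (fun p : ℝ × ℝ => G p.1 p.2) (Icc 0 b ×ˢ Icc T₀ T₁))
    (hderθ : ∀ θ ∈ Ioo 0 b, ∀ t ∈ Ioc T₀ T₁, HasDerivAt (fun x => G x t) (Gθ θ t) θ)
    (hderθθ : ∀ θ ∈ Ioo 0 b, ∀ t ∈ Ioc T₀ T₁, HasDerivAt (fun x => Gθ x t) (Gθθ θ t) θ)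
    (hdert : ∀ θ ∈ Ioo 0 b, ∀ t ∈ Ioc T₀ T₁, HasDerivAt (fun s => G θ s) (Gt θ t) t)
    (hop : ∀ θ ∈ Ioo 0 b, ∀ t ∈ Ioc T₀ T₁, lswOp κ θ (Gθθ θ t) (Gθ θ t) (Gt θ t) ≤ 0)
    (hbot : ∀ θ ∈ Icc 0 b, 0 ≤ G θ T₀)
    (hleft : ∀ t ∈ Icc T₀ T₁, 0 ≤ G 0 t)
    (hright : ∀ t ∈ Ioc T₀ T₁, ∀ η, 0 < η → ∃ θ ∈ Ioo 0 b, G θ t < G b t + η * (b - θ)) :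
    ∀ θ ∈ Icc 0 b, ∀ t ∈ Icc T₀ T₁, 0 ≤ G θ t := by
  intro θ hθ t ht
  set p := lswQ κ / 2 with hp
  have hp0 : 0 < p := by rw [hp]; exact half_pos (lswQ_pos hκ)
  have hp1 : p ≤ 1 := by
    rw [hp]; have := lswQ_lt_one hκ; linarith
  have hθp : 0 ≤ θ ^ p := Real.rpow_nonneg hθ.1 p
  -- it suffices to prove `G + ε (θ^p + 1) > 0` for every `ε > 0`
  suffices key : ∀ ε, 0 < ε → 0 < G θ t + ε * (θ ^ p + 1) by
    by_contra hneg
    push Not at hneg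
    have hε : 0 < -G θ t / (2 * (θ ^ p + 1)) := div_pos (by linarith) (by linarith)
    have := key _ hε
    have e : G θ t + -G θ t / (2 * (θ ^ p + 1)) * (θ ^ p + 1) = G θ t / 2 := by
      field_simp; ring
    rw [e] at this
    linarith
  intro ε hε
  -- the perturbed function and its derivative data
  have hrp : ∀ x, 0 < x → HasDerivAt (fun y : ℝ => ε * (y ^ p + 1)) (ε * (p * x ^ (p - 1))) x :=
    fun x hx => ((Real.hasDerivAt_rpow_const (Or.inl hx.ne')).add_const 1).const_mul ε
  have hrp2 : ∀ x, 0 < x →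
      HasDerivAt (fun y : ℝ => ε * (p * y ^ (p - 1))) (ε * (p * ((p - 1) * x ^ (p - 2)))) x := by
    intro x hx
    have := ((Real.hasDerivAt_rpow_const (p := p - 1) (Or.inl hx.ne')).const_mul p).const_mul ε
    rw [show p - 1 - 1 = p - 2 by ring] at this
    exact this
  refine lsw_maxPrinciple_strict (κ := κ) (b := b) (T₀ := T₀) (T₁ := T₁) (by linarith)
    (F := fun θ t => G θ t + ε * (θ ^ p + 1))
    (Fθ := fun θ t => Gθ θ t + ε * (p * θ ^ (p - 1)))
    (Fθθ := fun θ t => Gθθ θ t + ε * (p * ((p - 1) * θ ^ (p - 2))))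
    (Ft := fun θ t => Gt θ t + 0) ?_ ?_ ?_ ?_ ?_ ?_ ?_ ?_ θ hθ t ht
  · -- continuity
    refine hcont.add (Continuous.continuousOn ?_)
    exact continuous_const.mul ((continuous_fst.rpow_const fun _ => Or.inr hp0.le).add
      continuous_const)
  · intro θ hθ t ht
    exact (hderθ θ hθ t ht).add (hrp θ hθ.1)
  · intro θ hθ t ht
    exact (hderθθ θ hθ t ht).add (hrp2 θ hθ.1)
  · intro θ hθ t ht
    exact (hdert θ hθ t ht).add (hasDerivAt_const t (ε * (θ ^ p + 1)))
  · intro θ hθ t ht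
    rw [lswOp_add]
    have h1 := hop θ hθ t ht
    have h2 := lswOp_rpow_neg hκ hθ.1 (hθ.2.trans_le hb')
    have e : lswOp κ θ (ε * (p * ((p - 1) * θ ^ (p - 2)))) (ε * (p * θ ^ (p - 1))) 0 =
        ε * lswOp κ θ (p * ((p - 1) * θ ^ (p - 2))) (p * θ ^ (p - 1)) 0 := by
      rw [← lswOp_smul, mul_zero]
    rw [e]
    exact add_neg_of_nonpos_of_neg h1 (mul_neg_of_pos_of_neg hε h2)
  · intro θ hθ
    have := hbot θ hθ
    have := Real.rpow_nonneg hθ.1 p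
    nlinarith
  · intro t ht
    have := hleft t ht
    rw [Real.zero_rpow hp0.ne']
    linarith
  · -- right side: `F(b, t) ≤ 0` forces `F(θ, t) < 0` for the `θ` of the Dini hypothesis
    intro t ht hle
    have hη : 0 < ε * (p * b ^ (p - 1)) := by
      have := Real.rpow_pos_of_pos hb (p - 1)
      positivity
    obtain ⟨θ, hθ, hG⟩ := hright t ht _ hη
    refine ⟨θ, hθ, ?_⟩
    have hconc := mul_rpow_sub_one_mul_sub_le hp0.le hp1 hb hθ.1.le
    show G θ t + ε * (θ ^ p + 1) < 0
    have hle' : G b t + ε * (b ^ p + 1) ≤ 0 := hle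
    have hkey : ε * (p * b ^ (p - 1)) * (b - θ) ≤ ε * (b ^ p - θ ^ p) := by
      have := mul_le_mul_of_nonneg_left hconc hε.le
      linarith [this]
    linarith

end MaxPrinciple

/-! ### Step 3 of (2.17) on `[0, 2π] × [1, ∞)`, split -/

section Comparison

open Real

variable {κ : ℝ} {g gθ gθθ gt : ℝ → ℝ → ℝ}

/-- `H(·, t)` is flat at `2π`: for every `η > 0` there is `δ > 0` with
`|H(2π, t) - H(θ, t)| ≤ η (2π - θ)` for `θ ∈ (2π - δ, 2π)` (`∂_θ H(2π, t) = 0`). [folklore] -/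
theorem lswH_flat_two_pi (κ t : ℝ) {η : ℝ} (hη : 0 < η) :
    ∃ δ, 0 < δ ∧ ∀ θ ∈ Ioo (2 * π - δ) (2 * π),
      |lswH κ (2 * π) t - lswH κ θ t| ≤ η * (2 * π - θ) := by
  have hs2π : Real.sin (2 * π / 4) ≠ 0 := by
    rw [show 2 * π / 4 = π / 2 by ring, Real.sin_pi_div_two]; exact one_ne_zero
  have hder : HasDerivAt (fun x => lswH κ x t) 0 (2 * π) := by
    have := hasDerivAt_lswH_theta (κ := κ) t hs2π
    rwa [lswHθ_two_pi] at this
  rw [hasDerivAt_iff_isLittleO, Asymptotics.isLittleO_iff] at hder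
  have hev := hder hη
  simp only [smul_zero, sub_zero] at hev
  obtain ⟨δ, hδ, hball⟩ := Metric.eventually_nhds_iff.1 hev
  refine ⟨δ, hδ, fun θ hθ ↦ ?_⟩
  have hdist : dist θ (2 * π) < δ := by
    rw [Real.dist_eq, abs_sub_comm, abs_of_pos (by linarith [hθ.2])]; linarith [hθ.1]
  have h := hball hdist
  rw [Real.norm_eq_abs, Real.norm_eq_abs, abs_of_neg (by linarith [hθ.2] : θ - 2 * π < 0)] at h
  rw [abs_sub_comm]
  linarith

/-- **Step 3 of (2.17), upper function, from the Dini condition** (LSW p. 8): if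
`g(θ, 1) ≤ c₁ H(θ, 1)` on `[0, 2π]`, `g` solves the PDE with the Dirichlet condition at `0`,
and for every `t > 0`, `η > 0`, `δ > 0` some `θ ∈ (2π - δ, 2π)` has
`g(2π, t) - g(θ, t) < η (2π - θ)` (lower left Dini derivative `≤ 0`), then
`g(θ, t) ≤ c₁ H(θ, t)` for all `t ≥ 1`. [cite: LawlerSchrammWernerEJP2002, proof of Thm. 1.2 (p. 8)] -/
theorem lsw_comparison_step3_upper (hκ : 4 < κ)
    (hcont : ContinuousOn (fun p : ℝ × ℝ => g p.1 p.2) (Icc 0 (2 * π) ×ˢ Ici 1))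
    (hderθ : ∀ θ ∈ Ioo 0 (2 * π), ∀ t ∈ Ioi (0 : ℝ), HasDerivAt (fun x => g x t) (gθ θ t) θ)
    (hderθθ : ∀ θ ∈ Ioo 0 (2 * π), ∀ t ∈ Ioi (0 : ℝ), HasDerivAt (fun x => gθ x t) (gθθ θ t) θ)
    (hdert : ∀ θ ∈ Ioo 0 (2 * π), ∀ t ∈ Ioi (0 : ℝ), HasDerivAt (fun s => g θ s) (gt θ t) t)
    (hpde : ∀ θ ∈ Ioo 0 (2 * π), ∀ t ∈ Ioi (0 : ℝ), lswOp κ θ (gθθ θ t) (gθ θ t) (gt θ t) = 0)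
    (hdir : ∀ t, 0 < t → g 0 t = 0)
    (hdini : ∀ t, 0 < t → ∀ η, 0 < η → ∀ δ, 0 < δ → ∃ θ ∈ Ioo (2 * π - δ) (2 * π),
      g (2 * π) t - g θ t < η * (2 * π - θ))
    {c₁ : ℝ} (hc₁ : 0 ≤ c₁) (h₁ : ∀ θ ∈ Icc 0 (2 * π), g θ 1 ≤ c₁ * lswH κ θ 1) :
    ∀ t, 1 ≤ t → ∀ θ ∈ Icc 0 (2 * π), g θ t ≤ c₁ * lswH κ θ t := by
  have hπ := Real.pi_pos
  have h2π : (0 : ℝ) < 2 * π := by linarith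
  have hsin : ∀ θ ∈ Ioo 0 (2 * π), Real.sin (θ / 4) ≠ 0 :=
    fun θ hθ => (sin_quarter_pos hθ.1 hθ.2.le).ne'
  have hHcont := continuous_lswH hκ
  intro T hT θ hθ
  have h01 : ∀ t ∈ Ioc (1 : ℝ) T, t ∈ Ioi (0 : ℝ) := fun t ht => lt_trans zero_lt_one ht.1
  have hcontT : ContinuousOn (fun p : ℝ × ℝ => g p.1 p.2) (Icc 0 (2 * π) ×ˢ Icc 1 T) :=
    hcont.mono (prod_mono le_rfl Icc_subset_Ici_self)
  have key := lsw_maxPrinciple_dini (κ := κ) (b := 2 * π) (T₀ := 1) (T₁ := T) hκ h2π le_rfl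
    (G := fun θ t => c₁ * lswH κ θ t - g θ t)
    (Gθ := fun θ t => c₁ * lswHθ κ θ t - gθ θ t)
    (Gθθ := fun θ t => c₁ * lswHθθ κ θ t - gθθ θ t)
    (Gt := fun θ t => c₁ * (-lswLambda κ * lswH κ θ t) - gt θ t)
    ((hHcont.continuousOn.const_smul c₁).sub hcontT)
    (fun θ hθ t ht => ((hasDerivAt_lswH_theta t (hsin θ hθ)).const_mul c₁).sub
      (hderθ θ hθ t (h01 t ht)))
    (fun θ hθ t ht => ((hasDerivAt_lswHθ_theta t (hsin θ hθ)).const_mul c₁).sub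
      (hderθθ θ hθ t (h01 t ht)))
    (fun θ hθ t ht => ((hasDerivAt_lswH_t κ θ t).const_mul c₁).sub (hdert θ hθ t (h01 t ht)))
    ?_ ?_ ?_ ?_ θ hθ T ⟨hT, le_rfl⟩
  · linarith
  · intro θ hθ t ht
    have e : lswOp κ θ (c₁ * lswHθθ κ θ t - gθθ θ t) (c₁ * lswHθ κ θ t - gθ θ t)
        (c₁ * (-lswLambda κ * lswH κ θ t) - gt θ t) =
        c₁ * lswOp κ θ (lswHθθ κ θ t) (lswHθ κ θ t) (-lswLambda κ * lswH κ θ t) -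
          lswOp κ θ (gθθ θ t) (gθ θ t) (gt θ t) := by
      unfold lswOp; ring
    rw [e, lswOp_lswH hκ hθ.1 hθ.2, hpde θ hθ t (h01 t ht)]
    simp
  · intro θ hθ
    show 0 ≤ c₁ * lswH κ θ 1 - g θ 1
    linarith [h₁ θ hθ]
  · intro t ht
    show 0 ≤ c₁ * lswH κ 0 t - g 0 t
    rw [lswH_zero_left hκ, hdir t (by linarith [ht.1])]; simp
  · -- the Dini condition for `G = c₁ H - g` at `2π`
    intro t ht η hη
    have ht0 : 0 < t := by linarith [ht.1]
    -- `H` is flat at `2π` (tolerance `η/(2(c₁ + 1))`), `g` is Dini-flat (tolerance `η/2`)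
    have hη' : 0 < η / (2 * (c₁ + 1)) := by positivity
    obtain ⟨δ, hδ, hHflat⟩ := lswH_flat_two_pi κ t hη'
    obtain ⟨θ, hθ, hg⟩ := hdini t ht0 (η / 2) (half_pos hη) (min δ (2 * π)) (lt_min hδ h2π)
    have hθδ : θ ∈ Ioo (2 * π - δ) (2 * π) := ⟨by linarith [hθ.1, min_le_left δ (2 * π)], hθ.2⟩
    have hθ0 : 0 < θ := by linarith [hθ.1, min_le_right δ (2 * π)]
    refine ⟨θ, ⟨hθ0, hθ.2⟩, ?_⟩
    show c₁ * lswH κ θ t - g θ t < c₁ * lswH κ (2 * π) t - g (2 * π) t + η * (2 * π - θ)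
    have hH := hHflat θ hθδ
    have hpos : 0 < 2 * π - θ := by linarith [hθ.2]
    have hHle : lswH κ θ t - lswH κ (2 * π) t ≤ η / (2 * (c₁ + 1)) * (2 * π - θ) := by
      have := neg_abs_le (lswH κ (2 * π) t - lswH κ θ t)
      linarith
    have h1 : c₁ * (lswH κ θ t - lswH κ (2 * π) t) ≤ c₁ * (η / (2 * (c₁ + 1)) * (2 * π - θ)) :=
      mul_le_mul_of_nonneg_left hHle hc₁
    have hfrac : c₁ * (η / (2 * (c₁ + 1))) ≤ η / 2 := by
      rw [mul_div_assoc', div_le_div_iff₀ (by positivity) (by positivity)]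
      nlinarith
    have h1' : c₁ * (η / (2 * (c₁ + 1)) * (2 * π - θ)) ≤ η / 2 * (2 * π - θ) :=
      calc c₁ * (η / (2 * (c₁ + 1)) * (2 * π - θ)) = c₁ * (η / (2 * (c₁ + 1))) * (2 * π - θ) := by
            ring
        _ ≤ η / 2 * (2 * π - θ) := mul_le_mul_of_nonneg_right hfrac hpos.le
    linarith [mul_pos hη hpos]

/-- **Step 3 of (2.17), lower function, from monotonicity at `2π`** (LSW p. 8): if
`H(θ, 1) ≤ c₂ g(θ, 1)` on `[0, 2π]`, `g` solves the PDE with the Dirichlet condition at `0`, and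
`g(θ, t) ≤ g(2π, t)` for `θ ∈ (0, 2π)`, `t > 0`, then `H(θ, t) ≤ c₂ g(θ, t)` for all `t ≥ 1`.
[cite: LawlerSchrammWernerEJP2002, proof of Thm. 1.2 (p. 8)] -/
theorem lsw_comparison_step3_lower (hκ : 4 < κ)
    (hcont : ContinuousOn (fun p : ℝ × ℝ => g p.1 p.2) (Icc 0 (2 * π) ×ˢ Ici 1))
    (hderθ : ∀ θ ∈ Ioo 0 (2 * π), ∀ t ∈ Ioi (0 : ℝ), HasDerivAt (fun x => g x t) (gθ θ t) θ)
    (hderθθ : ∀ θ ∈ Ioo 0 (2 * π), ∀ t ∈ Ioi (0 : ℝ), HasDerivAt (fun x => gθ x t) (gθθ θ t) θ)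
    (hdert : ∀ θ ∈ Ioo 0 (2 * π), ∀ t ∈ Ioi (0 : ℝ), HasDerivAt (fun s => g θ s) (gt θ t) t)
    (hpde : ∀ θ ∈ Ioo 0 (2 * π), ∀ t ∈ Ioi (0 : ℝ), lswOp κ θ (gθθ θ t) (gθ θ t) (gt θ t) = 0)
    (hdir : ∀ t, 0 < t → g 0 t = 0)
    (hle : ∀ t, 0 < t → ∀ θ ∈ Ioo 0 (2 * π), g θ t ≤ g (2 * π) t)
    {c₂ : ℝ} (hc₂ : 0 ≤ c₂) (h₂ : ∀ θ ∈ Icc 0 (2 * π), lswH κ θ 1 ≤ c₂ * g θ 1) :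
    ∀ t, 1 ≤ t → ∀ θ ∈ Icc 0 (2 * π), lswH κ θ t ≤ c₂ * g θ t := by
  have hπ := Real.pi_pos
  have h2π : (0 : ℝ) < 2 * π := by linarith
  have hsin : ∀ θ ∈ Ioo 0 (2 * π), Real.sin (θ / 4) ≠ 0 :=
    fun θ hθ => (sin_quarter_pos hθ.1 hθ.2.le).ne'
  have hHcont := continuous_lswH hκ
  intro T hT θ hθ
  have h01 : ∀ t ∈ Ioc (1 : ℝ) T, t ∈ Ioi (0 : ℝ) := fun t ht => lt_trans zero_lt_one ht.1
  have hcontT : ContinuousOn (fun p : ℝ × ℝ => g p.1 p.2) (Icc 0 (2 * π) ×ˢ Icc 1 T) :=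
    hcont.mono (prod_mono le_rfl Icc_subset_Ici_self)
  have key := lsw_maxPrinciple_dini (κ := κ) (b := 2 * π) (T₀ := 1) (T₁ := T) hκ h2π le_rfl
    (G := fun θ t => c₂ * g θ t - lswH κ θ t)
    (Gθ := fun θ t => c₂ * gθ θ t - lswHθ κ θ t)
    (Gθθ := fun θ t => c₂ * gθθ θ t - lswHθθ κ θ t)
    (Gt := fun θ t => c₂ * gt θ t - (-lswLambda κ * lswH κ θ t))
    ((hcontT.const_smul c₂).sub hHcont.continuousOn)
    (fun θ hθ t ht => ((hderθ θ hθ t (h01 t ht)).const_mul c₂).sub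
      (hasDerivAt_lswH_theta t (hsin θ hθ)))
    (fun θ hθ t ht => ((hderθθ θ hθ t (h01 t ht)).const_mul c₂).sub
      (hasDerivAt_lswHθ_theta t (hsin θ hθ)))
    (fun θ hθ t ht => ((hdert θ hθ t (h01 t ht)).const_mul c₂).sub (hasDerivAt_lswH_t κ θ t))
    ?_ ?_ ?_ ?_ θ hθ T ⟨hT, le_rfl⟩
  · linarith
  · intro θ hθ t ht
    have e : lswOp κ θ (c₂ * gθθ θ t - lswHθθ κ θ t) (c₂ * gθ θ t - lswHθ κ θ t)
        (c₂ * gt θ t - (-lswLambda κ * lswH κ θ t)) =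
        c₂ * lswOp κ θ (gθθ θ t) (gθ θ t) (gt θ t) -
          lswOp κ θ (lswHθθ κ θ t) (lswHθ κ θ t) (-lswLambda κ * lswH κ θ t) := by
      unfold lswOp; ring
    rw [e, lswOp_lswH hκ hθ.1 hθ.2, hpde θ hθ t (h01 t ht)]
    simp
  · intro θ hθ
    show 0 ≤ c₂ * g θ 1 - lswH κ θ 1
    linarith [h₂ θ hθ]
  · intro t ht
    show 0 ≤ c₂ * g 0 t - lswH κ 0 t
    rw [lswH_zero_left hκ, hdir t (by linarith [ht.1])]; simp
  · -- the Dini condition for `G = c₂ g - H` at `2π`: `g(θ) ≤ g(2π)` and `H` flat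
    intro t ht η hη
    have ht0 : 0 < t := by linarith [ht.1]
    obtain ⟨δ, hδ, hHflat⟩ := lswH_flat_two_pi κ t (half_pos hη)
    -- any `θ ∈ (2π - δ, 2π) ∩ (0, 2π)` will do
    set θ₁ : ℝ := 2 * π - min δ (2 * π) / 2 with hθ₁
    have hm : 0 < min δ (2 * π) := lt_min hδ h2π
    have hθ₁lt : θ₁ < 2 * π := by rw [hθ₁]; linarith
    have hθ₁0 : 0 < θ₁ := by
      rw [hθ₁]; linarith [min_le_right δ (2 * π)]
    have hθ₁δ : θ₁ ∈ Ioo (2 * π - δ) (2 * π) :=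
      ⟨by rw [hθ₁]; linarith [min_le_left δ (2 * π)], hθ₁lt⟩
    refine ⟨θ₁, ⟨hθ₁0, hθ₁lt⟩, ?_⟩
    show c₂ * g θ₁ t - lswH κ θ₁ t < c₂ * g (2 * π) t - lswH κ (2 * π) t + η * (2 * π - θ₁)
    have hg := mul_le_mul_of_nonneg_left (hle t ht0 θ₁ ⟨hθ₁0, hθ₁lt⟩) hc₂
    have hH := hHflat θ₁ hθ₁δ
    have hpos : 0 < 2 * π - θ₁ := by linarith
    have hHle : lswH κ (2 * π) t - lswH κ θ₁ t ≤ η / 2 * (2 * π - θ₁) :=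
      (le_abs_self _).trans hH
    linarith [mul_pos hη hpos]


/-! ### (2.17) with explicit constants, split -/

/-- **The upper half of (2.17) from the Dini condition**, with the explicit constant of
`LawlerSchrammWerner2002_comparison_explicit`: under continuity, `C^{2,1}` regularity, the PDE,
the Dirichlet condition at `0`, the bounds `0 ≤ g ≤ 1`, and the Dini condition at `2π`
(for all `t > 0`, `η > 0`, `δ > 0` some `θ ∈ (2π - δ, 2π)` has `g(2π, t) - g(θ, t) < η (2π - θ)`),
`g(θ, t) ≤ c₁ H(θ, t)` for `t ≥ 1`, `c₁ = (1 + π²)/(sin(π/4)^q e^{-λ}) + π²/sin(1/4)^q`. No lower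
bounds on `g` are needed for this half. [cite: LawlerSchrammWernerEJP2002, proof of Thm. 1.2 (p. 8), (2.17)] -/
theorem LawlerSchrammWerner2002_comparison_upper (hκ : 4 < κ)
    (hcont : ContinuousOn (fun p : ℝ × ℝ => g p.1 p.2) (Icc 0 (2 * π) ×ˢ Ici 0))
    (hderθ : ∀ θ ∈ Ioo 0 (2 * π), ∀ t ∈ Ioi (0 : ℝ), HasDerivAt (fun x => g x t) (gθ θ t) θ)
    (hderθθ : ∀ θ ∈ Ioo 0 (2 * π), ∀ t ∈ Ioi (0 : ℝ), HasDerivAt (fun x => gθ x t) (gθθ θ t) θ)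
    (hdert : ∀ θ ∈ Ioo 0 (2 * π), ∀ t ∈ Ioi (0 : ℝ), HasDerivAt (fun s => g θ s) (gt θ t) t)
    (hpde : ∀ θ ∈ Ioo 0 (2 * π), ∀ t ∈ Ioi (0 : ℝ), lswOp κ θ (gθθ θ t) (gθ θ t) (gt θ t) = 0)
    (hdir : ∀ t, 0 < t → g 0 t = 0)
    (hdini : ∀ t, 0 < t → ∀ η, 0 < η → ∀ δ, 0 < δ → ∃ θ ∈ Ioo (2 * π - δ) (2 * π),
      g (2 * π) t - g θ t < η * (2 * π - θ))
    (hbd : ∀ θ ∈ Icc 0 (2 * π), ∀ t, 0 ≤ t → g θ t ∈ Icc (0 : ℝ) 1) :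
    ∀ t, 1 ≤ t → ∀ θ ∈ Icc 0 (2 * π),
      g θ t ≤ ((1 + π ^ 2) / (Real.sin (π / 4) ^ lswQ κ * Real.exp (-(lswLambda κ * 1))) +
        π ^ 2 / (Real.sin (1 / 4) ^ lswQ κ * Real.exp (-(lswLambda κ * 0)))) * lswH κ θ t := by
  have hπ := Real.pi_pos
  have hπ3 : (3 : ℝ) < π := Real.pi_gt_three
  have hA0 : 0 < Real.sin (π / 4) ^ lswQ κ * Real.exp (-(lswLambda κ * 1)) :=
    mul_pos (Real.rpow_pos_of_pos (sin_quarter_pos hπ (by linarith)) _) (Real.exp_pos _)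
  have hB0 : 0 < Real.sin (1 / 4) ^ lswQ κ * Real.exp (-(lswLambda κ * 0)) :=
    mul_pos (Real.rpow_pos_of_pos (sin_quarter_pos one_pos (by linarith)) _) (Real.exp_pos _)
  set A := Real.sin (π / 4) ^ lswQ κ * Real.exp (-(lswLambda κ * 1)) with hA
  set B := Real.sin (1 / 4) ^ lswQ κ * Real.exp (-(lswLambda κ * 0)) with hB
  set c₁ : ℝ := (1 + π ^ 2) / A + π ^ 2 / B with hc₁
  have hc₁0 : 0 < c₁ := by positivity
  have hxA : 0 ≤ (1 + π ^ 2) / A := by positivity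
  have hxB : 0 ≤ π ^ 2 / B := by positivity
  have hc₁A : 1 + π ^ 2 ≤ c₁ * A := by
    have e : (1 + π ^ 2) / A * A = 1 + π ^ 2 := div_mul_cancel₀ _ hA0.ne'
    have : c₁ * A = (1 + π ^ 2) / A * A + π ^ 2 / B * A := by rw [hc₁]; ring
    rw [this, e]; linarith [mul_nonneg hxB hA0.le]
  have hc₁B : π ^ 2 ≤ c₁ * B := by
    have e : π ^ 2 / B * B = π ^ 2 := div_mul_cancel₀ _ hB0.ne'
    have : c₁ * B = (1 + π ^ 2) / A * B + π ^ 2 / B * B := by rw [hc₁]; ring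
    rw [this, e]; linarith [mul_nonneg hxA hB0.le]
  -- Step 1 on `[0, π] × [0, 1]`
  have hcont1 : ContinuousOn (fun p : ℝ × ℝ => g p.1 p.2) (Icc 0 π ×ˢ Icc 0 1) :=
    hcont.mono (prod_mono (Icc_subset_Icc le_rfl (by linarith)) Icc_subset_Ici_self)
  have step1u := lsw_comparison_step1_upper hκ hcont1 hderθ hderθθ hdert hpde hdir hbd hc₁0.le
    hc₁A hc₁B
  -- Step 2 at `t = 1` on `[0, 2π]`
  have step2u : ∀ θ ∈ Icc 0 (2 * π), g θ 1 ≤ c₁ * lswH κ θ 1 := by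
    intro θ hθ
    rcases le_or_gt θ π with hθπ | hθπ
    · have := step1u θ ⟨hθ.1, hθπ⟩; nlinarith [sq_nonneg θ]
    · have hg := (hbd θ hθ 1 zero_le_one).2
      have hH : c₁ * A ≤ c₁ * lswH κ θ 1 :=
        mul_le_mul_of_nonneg_left (lswH_ge hκ hπ.le hθπ.le hθ.2 le_rfl) hc₁0.le
      nlinarith [sq_nonneg π]
  -- Step 3 on `[0, 2π] × [1, ∞)`
  have hcont3 : ContinuousOn (fun p : ℝ × ℝ => g p.1 p.2) (Icc 0 (2 * π) ×ˢ Ici 1) :=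
    hcont.mono (prod_mono le_rfl (Ici_subset_Ici.2 zero_le_one))
  exact lsw_comparison_step3_upper hκ hcont3 hderθ hderθθ hdert hpde hdir hdini hc₁0.le step2u

/-- **The lower half of (2.17) from monotonicity at `2π`**, with the explicit constant of
`LawlerSchrammWerner2002_comparison_explicit`: under continuity, `C^{2,1}` regularity, the PDE,
the Dirichlet condition at `0`, the bounds `0 ≤ g ≤ 1`, positive lower bounds `m₁, m₂, m₃` of
`g` on `{π} × [0, 1]`, `[1, π] × {0}`, `[π, 2π] × {1}`, and `g(θ, t) ≤ g(2π, t)` for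
`θ ∈ (0, 2π)`, `t > 0`: `H(θ, t)/c₂ ≤ g(θ, t)` for `t ≥ 1`, `c₂ = (1 + π²)/m₁ + π²/m₂ + 1/m₃`.
[cite: LawlerSchrammWernerEJP2002, proof of Thm. 1.2 (p. 8), (2.17)] -/
theorem LawlerSchrammWerner2002_comparison_lower (hκ : 4 < κ)
    (hcont : ContinuousOn (fun p : ℝ × ℝ => g p.1 p.2) (Icc 0 (2 * π) ×ˢ Ici 0))
    (hderθ : ∀ θ ∈ Ioo 0 (2 * π), ∀ t ∈ Ioi (0 : ℝ), HasDerivAt (fun x => g x t) (gθ θ t) θ)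
    (hderθθ : ∀ θ ∈ Ioo 0 (2 * π), ∀ t ∈ Ioi (0 : ℝ), HasDerivAt (fun x => gθ x t) (gθθ θ t) θ)
    (hdert : ∀ θ ∈ Ioo 0 (2 * π), ∀ t ∈ Ioi (0 : ℝ), HasDerivAt (fun s => g θ s) (gt θ t) t)
    (hpde : ∀ θ ∈ Ioo 0 (2 * π), ∀ t ∈ Ioi (0 : ℝ), lswOp κ θ (gθθ θ t) (gθ θ t) (gt θ t) = 0)
    (hdir : ∀ t, 0 < t → g 0 t = 0)
    (hle : ∀ t, 0 < t → ∀ θ ∈ Ioo 0 (2 * π), g θ t ≤ g (2 * π) t)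
    (hbd : ∀ θ ∈ Icc 0 (2 * π), ∀ t, 0 ≤ t → g θ t ∈ Icc (0 : ℝ) 1)
    {m₁ m₂ m₃ : ℝ} (hm₁ : 0 < m₁) (hm₂ : 0 < m₂) (hm₃ : 0 < m₃)
    (hg₁ : ∀ t ∈ Icc (0 : ℝ) 1, m₁ ≤ g π t) (hg₂ : ∀ θ ∈ Icc (1 : ℝ) π, m₂ ≤ g θ 0)
    (hg₃ : ∀ θ ∈ Icc π (2 * π), m₃ ≤ g θ 1) :
    ∀ t, 1 ≤ t → ∀ θ ∈ Icc 0 (2 * π),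
      lswH κ θ t / ((1 + π ^ 2) / m₁ + π ^ 2 / m₂ + 1 / m₃) ≤ g θ t := by
  have hπ := Real.pi_pos
  have hπ3 : (3 : ℝ) < π := Real.pi_gt_three
  set c₂ : ℝ := (1 + π ^ 2) / m₁ + π ^ 2 / m₂ + 1 / m₃ with hc₂
  have hc₂0 : 0 < c₂ := by positivity
  have hx₁ : 0 ≤ (1 + π ^ 2) / m₁ := by positivity
  have hx₂ : 0 ≤ π ^ 2 / m₂ := by positivity
  have hx₃ : 0 ≤ 1 / m₃ := by positivity
  have hc₂m₁ : 1 + π ^ 2 ≤ c₂ * m₁ := by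
    have e : (1 + π ^ 2) / m₁ * m₁ = 1 + π ^ 2 := div_mul_cancel₀ _ hm₁.ne'
    have : c₂ * m₁ = (1 + π ^ 2) / m₁ * m₁ + π ^ 2 / m₂ * m₁ + 1 / m₃ * m₁ := by rw [hc₂]; ring
    rw [this, e]; linarith [mul_nonneg hx₂ hm₁.le, mul_nonneg hx₃ hm₁.le]
  have hc₂m₂ : π ^ 2 ≤ c₂ * m₂ := by
    have e : π ^ 2 / m₂ * m₂ = π ^ 2 := div_mul_cancel₀ _ hm₂.ne'
    have : c₂ * m₂ = (1 + π ^ 2) / m₁ * m₂ + π ^ 2 / m₂ * m₂ + 1 / m₃ * m₂ := by rw [hc₂]; ring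
    rw [this, e]; linarith [mul_nonneg hx₁ hm₂.le, mul_nonneg hx₃ hm₂.le]
  have hc₂m₃ : 1 ≤ c₂ * m₃ := by
    have e : 1 / m₃ * m₃ = 1 := div_mul_cancel₀ _ hm₃.ne'
    have : c₂ * m₃ = (1 + π ^ 2) / m₁ * m₃ + π ^ 2 / m₂ * m₃ + 1 / m₃ * m₃ := by rw [hc₂]; ring
    rw [this, e]; linarith [mul_nonneg hx₁ hm₃.le, mul_nonneg hx₂ hm₃.le]
  -- Step 1 on `[0, π] × [0, 1]`
  have hcont1 : ContinuousOn (fun p : ℝ × ℝ => g p.1 p.2) (Icc 0 π ×ˢ Icc 0 1) :=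
    hcont.mono (prod_mono (Icc_subset_Icc le_rfl (by linarith)) Icc_subset_Ici_self)
  have step1l := lsw_comparison_step1_lower hκ hcont1 hderθ hderθθ hdert hpde hbd hg₁ hg₂
    hc₂0.le hc₂m₁ hc₂m₂
  -- Step 2 at `t = 1` on `[0, 2π]`
  have step2l : ∀ θ ∈ Icc 0 (2 * π), lswH κ θ 1 ≤ c₂ * g θ 1 := by
    intro θ hθ
    rcases le_or_gt θ π with hθπ | hθπ
    · have := step1l θ ⟨hθ.1, hθπ⟩; nlinarith [sq_nonneg θ]
    · have hH1 : lswH κ θ 1 ≤ 1 := lswH_le_one hκ hθ.1 hθ.2 zero_le_one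
      have hgm : c₂ * m₃ ≤ c₂ * g θ 1 := mul_le_mul_of_nonneg_left (hg₃ θ ⟨hθπ.le, hθ.2⟩) hc₂0.le
      linarith
  -- Step 3 on `[0, 2π] × [1, ∞)`
  have hcont3 : ContinuousOn (fun p : ℝ × ℝ => g p.1 p.2) (Icc 0 (2 * π) ×ˢ Ici 1) :=
    hcont.mono (prod_mono le_rfl (Ici_subset_Ici.2 zero_le_one))
  have step3 := lsw_comparison_step3_lower hκ hcont3 hderθ hderθθ hdert hpde hdir hle hc₂0.le step2l
  intro t ht θ hθ
  rw [div_le_iff₀ hc₂0]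
  linarith [step3 t ht θ hθ]

end Comparison

/-! ### THEOREM A split: exponential bounds from the diffusion under one-sided conditions -/

section TheoremA

variable {κ : ℝ≥0} (hκ : 4 < κ) {u : ℝ → ℝ} (hu : Antitone u) (hb : ∀ s, u s ∈ Icc (0 : ℝ) 1)
include hκ hu hb

/-- **THEOREM A, one-sided** (LSW's Thm. 1.2 at `θ = 2π`, from the diffusion). Let `κ > 4` and
`u : ℝ → [0, 1]` be antitone, `U = dataU u`, `V = dataV`, `g = renewalST κ V U` (so
`g(2π, t) = U(t)`), `λ = lswLambda κ`, `p₁ = P^1[Y_T = 2π]`. (i) If `u(3) ≥ m₀ > 0` and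
`g(θ, t) ≤ U(t)` for all `θ ∈ (0, 2π)`, `t > 0`, then `e^{-λt}/c₂ ≤ u(t)` for `t ≥ 1`,
`c₂ = ((1 + π²) + π² + 1)/(m₀ p₁)`. (ii) If for all `t > 0`, `η > 0`, `δ > 0` some
`θ ∈ (2π - δ, 2π)` has `U(t) - g(θ, t) < η (2π - θ)`, then `u(t) ≤ c₁ e^{-λ(t - 2)}` for
`t ≥ 3`, `c₁ = c₁(κ)` as in `LawlerSchrammWerner2002_comparison_explicit`. All other hypotheses
of the comparison are supplied by `RadialBesselRenewal`, as in
`LawlerSchrammWerner2002_exp_bounds_of_neumann`. [cite: LawlerSchrammWernerEJP2002, Thm. 1.2 and its proof (p. 8)] -/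
theorem LawlerSchrammWerner2002_exp_bounds_oneSided :
    (∀ {m₀ : ℝ}, 0 < m₀ → m₀ ≤ u 3 →
      (∀ t, 0 < t → ∀ θ ∈ Ioo 0 (2 * Real.pi), renewalST κ dataV (dataU u) θ t ≤ dataU u t) →
      ∀ t, 1 ≤ t → Real.exp (-(lswLambda κ * t)) /
        ((1 + Real.pi ^ 2) / (m₀ * preWienerMeasure.real (sleExitsTop κ 1)) +
          Real.pi ^ 2 / (m₀ * preWienerMeasure.real (sleExitsTop κ 1)) +
          1 / (m₀ * preWienerMeasure.real (sleExitsTop κ 1))) ≤ u t) ∧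
    ((∀ t, 0 < t → ∀ η, 0 < η → ∀ δ, 0 < δ → ∃ θ ∈ Ioo (2 * Real.pi - δ) (2 * Real.pi),
        dataU u t - renewalST κ dataV (dataU u) θ t < η * (2 * Real.pi - θ)) →
      ∀ t, 3 ≤ t → u t ≤ ((1 + Real.pi ^ 2) / (Real.sin (Real.pi / 4) ^ lswQ κ * Real.exp (-(lswLambda κ * 1))) +
        Real.pi ^ 2 / (Real.sin (1 / 4) ^ lswQ κ * Real.exp (-(lswLambda κ * 0)))) *
        Real.exp (-(lswLambda κ * (t - 2)))) := by
  have hπ := Real.pi_gt_three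
  have hκ' : (4 : ℝ) < κ := by exact_mod_cast hκ
  -- the data
  set V := dataV with hVdef
  set U := dataU u with hUdef
  set V' : ℝ → ℝ := fun t ↦ tildeAvg bottomDatum (t + 1) - tildeAvg bottomDatum t with hV'def
  set U' : ℝ → ℝ := fun t ↦ tildeAvg u (t + 1) - tildeAvg u t with hU'def
  have hV : ∀ s, HasDerivAt V (V' s) s := hasDerivAt_tildeAvg_tildeAvg antitone_bottomDatum bottomDatum_mem_Icc
  have hU : ∀ s, HasDerivAt U (U' s) s := hasDerivAt_tildeAvg_tildeAvg hu hb
  have hV'c : Continuous V' := continuous_tildeAvg_shift_sub antitone_bottomDatum bottomDatum_mem_Icc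
  have hU'c : Continuous U' := continuous_tildeAvg_shift_sub hu hb
  have hVb : ∀ s, |V s| ≤ 1 := abs_tildeAvg_tildeAvg_le antitone_bottomDatum bottomDatum_mem_Icc
  have hUb : ∀ s, |U s| ≤ 1 := abs_tildeAvg_tildeAvg_le hu hb
  have hV'b : ∀ s, |V' s| ≤ 1 := abs_tildeAvg_shift_sub_le antitone_bottomDatum bottomDatum_mem_Icc
  have hU'b : ∀ s, |U' s| ≤ 1 := abs_tildeAvg_shift_sub_le hu hb
  have hVc : Continuous V := continuous_iff_continuousAt.2 fun s ↦ (hV s).continuousAt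
  have hUc : Continuous U := continuous_iff_continuousAt.2 fun s ↦ (hU s).continuousAt
  -- the solution and its derivative functions
  set g : ℝ → ℝ → ℝ := fun θ t ↦ renewalST κ V U θ t with hg
  set gθ : ℝ → ℝ → ℝ := fun θ t ↦ deriv (fun x ↦ g x t) θ with hgθ
  set gθθ : ℝ → ℝ → ℝ := fun θ t ↦ deriv (deriv fun x ↦ g x t) θ with hgθθ
  set gt : ℝ → ℝ → ℝ := fun θ t ↦ botST κ V' θ t + topST κ U' θ t with hgt
  have hcont : ContinuousOn (fun p : ℝ × ℝ ↦ g p.1 p.2) (Icc 0 (2 * Real.pi) ×ˢ Ici 0) :=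
    (continuousOn_renewalST_prod hκ hV hU hVb hV'b hUb hU'b).mono (prod_mono le_rfl (subset_univ _))
  have hderθ : ∀ θ ∈ Ioo 0 (2 * Real.pi), ∀ t ∈ Ioi (0 : ℝ), HasDerivAt (fun x ↦ g x t) (gθ θ t) θ :=
    fun θ hθ t _ ↦ hasDerivAt_renewalST_space hκ hV hV'c hU hU'c hVb hV'b hUb hU'b t hθ
  have hderθθ : ∀ θ ∈ Ioo 0 (2 * Real.pi), ∀ t ∈ Ioi (0 : ℝ), HasDerivAt (fun x ↦ gθ x t) (gθθ θ t) θ :=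
    fun θ hθ t _ ↦ hasDerivAt_deriv_renewalST_space hκ hV hV'c hU hU'c hVb hV'b hUb hU'b t hθ
  have hdert : ∀ θ ∈ Ioo 0 (2 * Real.pi), ∀ t ∈ Ioi (0 : ℝ), HasDerivAt (fun s ↦ g θ s) (gt θ t) t :=
    fun θ hθ t _ ↦ hasDerivAt_renewalST_time hV hV'c hU hU'c hVb hV'b hUb hU'b hθ t
  have hpde : ∀ θ ∈ Ioo 0 (2 * Real.pi), ∀ t ∈ Ioi (0 : ℝ), lswOp κ θ (gθθ θ t) (gθ θ t) (gt θ t) = 0 :=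
    fun θ hθ t _ ↦ lswOp_renewalST hκ hV hV'c hU hU'c hVb hV'b hUb hU'b t hθ
  have hdir : ∀ t, 0 < t → g 0 t = 0 := fun t ht ↦ by
    simp only [hg, renewalST_zero]; exact dataV_eq_zero ht.le
  have hbd : ∀ θ ∈ Icc 0 (2 * Real.pi), ∀ t, 0 ≤ t → g θ t ∈ Icc (0 : ℝ) 1 := fun θ _ t _ ↦
    renewalST_mem_Icc hκ hVc.measurable hUc.measurable
      (tildeAvg_tildeAvg_mem_Icc antitone_bottomDatum bottomDatum_mem_Icc) (tildeAvg_tildeAvg_mem_Icc hu hb) θ t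
  have h2π : (2 * Real.pi) ∈ Icc 0 (2 * Real.pi) := ⟨by linarith [Real.pi_pos], le_rfl⟩
  have hH : ∀ t, lswH κ (2 * Real.pi) t = Real.exp (-(lswLambda κ * t)) := fun t ↦ by
    rw [lswH, show 2 * Real.pi / 4 = Real.pi / 2 by ring, Real.sin_pi_div_two, Real.one_rpow, one_mul]
  have hg2π : ∀ t, g (2 * Real.pi) t = U t := fun t ↦ by simp only [hg, renewalST_two_pi]
  constructor
  · -- (i) the lower bound from monotonicity at `2π`
    intro m₀ hm₀ hm hle
    -- lower bounds on the three segments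
    set p₁ := preWienerMeasure.real (sleExitsTop κ 1) with hp₁
    have hp₁0 : 0 < p₁ := measureReal_sleExitsTop_one_pos hκ
    haveI := isProbabilityMeasure_preWienerMeasure'
    have hp₁1 : p₁ ≤ 1 := measureReal_le_one
    have hm1 : 0 < m₀ * p₁ := mul_pos hm₀ hp₁0
    have hlow : ∀ θ t, 1 ≤ θ → θ < 2 * Real.pi → t ≤ 1 → m₀ * p₁ ≤ g θ t := fun θ t h1 h2 ht ↦
      (mul_le_mul_of_nonneg_right hm hp₁0.le).trans (renewalST_lower hκ hu hb h1 h2 ht)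
    have hg₁ : ∀ t ∈ Icc (0 : ℝ) 1, m₀ * p₁ ≤ g Real.pi t := fun t ht ↦
      hlow _ _ (by linarith) (by linarith [Real.pi_pos]) ht.2
    have hg₂ : ∀ θ ∈ Icc (1 : ℝ) Real.pi, m₀ * p₁ ≤ g θ 0 := fun θ hθ ↦
      hlow _ _ hθ.1 (by linarith [hθ.2, Real.pi_pos]) zero_le_one
    have hg₃ : ∀ θ ∈ Icc Real.pi (2 * Real.pi), m₀ * p₁ ≤ g θ 1 := by
      intro θ hθ
      rcases eq_or_lt_of_le hθ.2 with h | h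
      · rw [h]
        simp only [hg, renewalST_two_pi]
        calc m₀ * p₁ ≤ m₀ * 1 := mul_le_mul_of_nonneg_left hp₁1 hm₀.le
          _ ≤ u 3 := by rw [mul_one]; exact hm
          _ = u (1 + 2) := by norm_num
          _ ≤ dataU u 1 := le_tildeAvg_tildeAvg hu 1
      · exact hlow _ _ (by linarith [hθ.1]) h le_rfl
    have hle' : ∀ t, 0 < t → ∀ θ ∈ Ioo 0 (2 * Real.pi), g θ t ≤ g (2 * Real.pi) t := by
      intro t ht θ hθ
      rw [hg2π]
      exact hle t ht θ hθ
    have hcomp := LawlerSchrammWerner2002_comparison_lower (κ := (κ : ℝ)) (g := g) (gθ := gθ)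
      (gθθ := gθθ) (gt := gt) hκ' hcont hderθ hderθθ hdert hpde hdir hle' hbd hm1 hm1 hm1 hg₁ hg₂ hg₃
    intro t ht
    have h := hcomp t ht (2 * Real.pi) h2π
    rw [hH, hg2π] at h
    exact h.trans (tildeAvg_tildeAvg_le hu t)
  · -- (ii) the upper bound from the Dini condition at `2π`
    intro hdini
    have hdini' : ∀ t, 0 < t → ∀ η, 0 < η → ∀ δ, 0 < δ → ∃ θ ∈ Ioo (2 * Real.pi - δ) (2 * Real.pi),
        g (2 * Real.pi) t - g θ t < η * (2 * Real.pi - θ) := by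
      intro t ht η hη δ hδ
      obtain ⟨θ, hθ, h⟩ := hdini t ht η hη δ hδ
      exact ⟨θ, hθ, by rwa [hg2π]⟩
    have hcomp := LawlerSchrammWerner2002_comparison_upper (κ := (κ : ℝ)) (g := g) (gθ := gθ)
      (gθθ := gθθ) (gt := gt) hκ' hcont hderθ hderθθ hdert hpde hdir hdini' hbd
    intro t ht
    have h := hcomp (t - 2) (by linarith) (2 * Real.pi) h2π
    rw [hH, hg2π] at h
    have hsand : u t ≤ U (t - 2) := by
      have := le_tildeAvg_tildeAvg hu (t - 2)
      rwa [show t - 2 + 2 = t by ring] at this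
    exact hsand.trans h

end TheoremA

/-! ### The two halves of the measure bounds (Koebe) -/

/-- **Lower measure bound from the lower exponential bound**: if `w(t) = ν{𝔯(K) ≤ e^{-t}}`
satisfies `c e^{-5t/48} ≤ w(t)` for `t ≥ 1`, then `C⁻¹ r^{5/48} ≤ ν{dist(0, K) < r}` for
`r ∈ (0, 1/2)`, `C = e^{5/48}/c` (the half of `measure_bounds_of_exp_bounds` not using Koebe:
`{𝔯 ≤ e^{-1} r} ⊆ {dist(0, K) < r}` by `dist(0, K) ≤ 𝔯`). [cite: LawlerSchrammWernerEJP2002, Thm. 1.2 and its proof (pp. 2, 4, 8)] -/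
theorem measure_lower_of_exp_lower {c : ℝ} (ν : ProbabilityMeasure (NonemptyCompacts ℂ))
    (hlow : ∀ t, 1 ≤ t → c * Real.exp (-(5 / 48 * t)) ≤ (ν : Measure (NonemptyCompacts ℂ)).real
      {K | Literature.Analysis.Complex.conformalRadius (K : Set ℂ) ≤ Real.exp (-t)}) :
    ∀ r : ℝ, 0 < r → r < 1 / 2 →
      c * Real.exp (-(5 / 48)) * r ^ (5 / 48 : ℝ) ≤
        (ν : Measure (NonemptyCompacts ℂ)).real (meetsBall r) := by
  intro r hr0 hr12
  set a : ℝ := 5 / 48 with ha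
  have hr1 : r < 1 := by linarith
  set t : ℝ := 1 - Real.log r with ht_def
  have ht1 : 1 ≤ t := by have := Real.log_neg hr0 hr1; linarith
  have hexp : Real.exp (-t) = Real.exp (-1) * r := by
    rw [ht_def, show -(1 - Real.log r) = -1 + Real.log r by ring, Real.exp_add, Real.exp_log hr0]
  have hsub : {K : NonemptyCompacts ℂ | Literature.Analysis.Complex.conformalRadius (K : Set ℂ) ≤ Real.exp (-t)} ⊆
      meetsBall r := by
    have : Real.exp (-1) < 1 := Real.exp_lt_one_iff.2 (by norm_num)
    refine setOf_conformalRadius_le_subset_meetsBall ?_ ?_ <;> rw [hexp] <;> nlinarith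
  have hmono := measureReal_mono (μ := (ν : Measure (NonemptyCompacts ℂ))) hsub (measure_ne_top _ _)
  have hlow' := hlow t ht1
  have hrpow : Real.exp (-(5 / 48 * t)) = Real.exp (-a) * r ^ a := by
    rw [ht_def, ha, Real.rpow_def_of_pos hr0, ← Real.exp_add]
    ring_nf
  rw [hrpow] at hlow'
  calc c * Real.exp (-(5 / 48)) * r ^ (5 / 48 : ℝ) = c * (Real.exp (-a) * r ^ a) := by rw [ha]; ring
    _ ≤ _ := hlow'
    _ ≤ _ := hmono

/-- **Upper measure bound from the upper exponential bound** (Koebe): if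
`w(t) = ν{𝔯(K) ≤ e^{-t}} ≤ c' e^{-5t/48}` for `t ≥ 3`, then `ν{dist(0, K) ≤ r} ≤ C r^{5/48}`
for `r ∈ (0, 1/2)` with `C` depending on `c'` and the Koebe constant only
(`{dist(0, K) ≤ r} ⊆ {𝔯 ≤ r/κ₀}`, `KoebeCovering κ₀`). [cite: LawlerSchrammWernerEJP2002, Thm. 1.2 and its proof (pp. 2, 4, 8)] -/
theorem measure_upper_of_exp_upper {κ₀ : ℝ} (hKoebe : Literature.Analysis.Complex.KoebeCovering κ₀)
    (hκ₀ : 0 < κ₀) {c' : ℝ} (hc' : 0 < c') :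
    ∃ C : ℝ, 0 < C ∧ ∀ ν : ProbabilityMeasure (NonemptyCompacts ℂ),
      (∀ t, 3 ≤ t → (ν : Measure (NonemptyCompacts ℂ)).real
        {K | Literature.Analysis.Complex.conformalRadius (K : Set ℂ) ≤ Real.exp (-t)} ≤ c' * Real.exp (-(5 / 48 * t))) →
      ∀ r : ℝ, 0 < r → r < 1 / 2 →
        (ν : Measure (NonemptyCompacts ℂ)).real (meetsClosedBall r) ≤ C * r ^ (5 / 48 : ℝ) := by
  have hA : 0 < κ₀⁻¹ := inv_pos.2 hκ₀
  set A : ℝ := κ₀⁻¹ with hA_def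
  set a : ℝ := 5 / 48 with ha
  set C : ℝ := max (c' * A ^ a) ((A * Real.exp 3) ^ a) with hCup
  have hC0 : 0 < C := lt_max_of_lt_left (by positivity)
  refine ⟨C, hC0, fun ν hup r hr0 hr12 => ?_⟩
  have hsub := meetsClosedBall_subset_setOf_conformalRadius_le hKoebe hκ₀ r
  have h4r : 0 < A * r := mul_pos hA hr0
  set t : ℝ := -Real.log (A * r) with ht_def
  have hexp : Real.exp (-t) = A * r := by rw [ht_def, neg_neg, Real.exp_log h4r]
  rw [← hexp] at hsub
  have hmono := measureReal_mono (μ := (ν : Measure (NonemptyCompacts ℂ))) hsub (measure_ne_top _ _)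
  have hra : 0 ≤ r ^ a := Real.rpow_nonneg hr0.le _
  rcases le_or_gt 3 t with ht2 | ht2
  · have hup' := hup t ht2
    have hrpow : Real.exp (-(5 / 48 * t)) = A ^ a * r ^ a := by
      rw [ht_def, ha, ← Real.mul_rpow hA.le hr0.le, Real.rpow_def_of_pos h4r]
      ring_nf
    rw [hrpow] at hup'
    calc (ν : Measure (NonemptyCompacts ℂ)).real (meetsClosedBall r) ≤ _ := hmono
      _ ≤ c' * (A ^ a * r ^ a) := hup'
      _ = (c' * A ^ a) * r ^ a := by ring
      _ ≤ C * r ^ a := mul_le_mul_of_nonneg_right (le_max_left _ _) hra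
  · -- `t < 3`: trivial bound
    have hbig : 1 < A * Real.exp 3 * r := by
      have : Real.exp (-3) < A * r := by
        rw [← hexp]; exact Real.exp_lt_exp.2 (by linarith)
      have e : Real.exp (-3) * Real.exp 3 = 1 := by rw [← Real.exp_add]; simp
      nlinarith [Real.exp_pos 3]
    have hone : 1 ≤ (A * Real.exp 3) ^ a * r ^ a := by
      rw [← Real.mul_rpow (by positivity) hr0.le]
      exact Real.one_le_rpow hbig.le (by norm_num [ha])
    calc (ν : Measure (NonemptyCompacts ℂ)).real (meetsClosedBall r) ≤ 1 := measureReal_le_one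
      _ ≤ (A * Real.exp 3) ^ a * r ^ a := hone
      _ ≤ C * r ^ a := mul_le_mul_of_nonneg_right (le_max_right _ _) hra

/-! ### At subsequential weak limits of `lswLaw` -/

/-- **The lower half of Theorem 1.2, uniformly at subsequential limits, from monotonicity of the
renewal extension.** There is `C > 0` such that for every weak limit `ν` of `lswLaw (R_k)`,
`R_k → ∞`, IF the renewal extension `g = renewalST 6 V (avg(avg w_ν))` of
`w_ν(t) = ν{𝔯(K) ≤ e^{-t}}` satisfies `g(θ, t) ≤ avg(avg w_ν)(t)` (`= g(2π, t)`) for all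
`θ ∈ (0, 2π)`, `t > 0` — after the identification (2.10), the monotonicity `𝔯(2π) ≤ 𝔯(θ)` of
LSW's sets `Q(θ) ⊆ Q(2π)` — then `C⁻¹ r^{5/48} ≤ ν{dist(0, K) < r}` for `r ∈ (0, 1/2)`
(`w_ν(3) ≥ m₀ > 0` uniformly by `exists_lower_bound_confRad_subseqLimits`, then
`LawlerSchrammWerner2002_exp_bounds_oneSided` (i) and `measure_lower_of_exp_lower`). No Neumann
condition, no half-plane estimate is involved. [cite: LawlerSchrammWernerEJP2002, Thm. 1.2 (lower bound)] -/
theorem exists_measure_lower_of_renewal_le :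
    ∃ C : ℝ, 0 < C ∧ ∀ (R : ℕ → ℝ) (ν : ProbabilityMeasure (NonemptyCompacts ℂ)),
      Tendsto R atTop atTop → Tendsto (lswLaw ∘ R) atTop (𝓝 ν) →
      (∀ t, 0 < t → ∀ θ ∈ Ioo 0 (2 * Real.pi), renewalST 6 dataV
          (dataU fun s ↦ (ν : Measure (NonemptyCompacts ℂ)).real
            {K | Literature.Analysis.Complex.conformalRadius (K : Set ℂ) ≤ Real.exp (-s)}) θ t ≤
        dataU (fun s ↦ (ν : Measure (NonemptyCompacts ℂ)).real
            {K | Literature.Analysis.Complex.conformalRadius (K : Set ℂ) ≤ Real.exp (-s)}) t) →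
      ∀ r : ℝ, 0 < r → r < 1 / 2 →
        C⁻¹ * r ^ (5 / 48 : ℝ) ≤ (ν : Measure (NonemptyCompacts ℂ)).real (meetsBall r) := by
  obtain ⟨m₀, hm₀, hlow⟩ := exists_lower_bound_confRad_subseqLimits
  have h6 : (4 : ℝ≥0) < 6 := by norm_num
  have hlam : lswLambda ((6 : ℝ≥0) : ℝ) = 5 / 48 := by
    rw [show ((6 : ℝ≥0) : ℝ) = 6 by norm_num]; exact lswLambda_six
  have hw : ∀ ν : ProbabilityMeasure (NonemptyCompacts ℂ),
      Antitone (fun s ↦ (ν : Measure (NonemptyCompacts ℂ)).real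
        {K | Literature.Analysis.Complex.conformalRadius (K : Set ℂ) ≤ Real.exp (-s)}) ∧
      ∀ s, (ν : Measure (NonemptyCompacts ℂ)).real
        {K | Literature.Analysis.Complex.conformalRadius (K : Set ℂ) ≤ Real.exp (-s)} ∈ Icc (0 : ℝ) 1 := by
    intro ν
    refine ⟨fun a b hab ↦ measureReal_mono (fun K hK ↦ ?_) (measure_ne_top _ _),
      fun s ↦ ⟨measureReal_nonneg, measureReal_le_one⟩⟩
    have hK' : Literature.Analysis.Complex.conformalRadius (K : Set ℂ) ≤ Real.exp (-b) := hK
    show Literature.Analysis.Complex.conformalRadius (K : Set ℂ) ≤ Real.exp (-a)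
    exact hK'.trans (Real.exp_le_exp.2 (by linarith))
  have hπ := Real.pi_gt_three
  have hp₁0 : 0 < preWienerMeasure.real (sleExitsTop 6 1) := measureReal_sleExitsTop_one_pos h6
  have hc₂0 : 0 < (1 + Real.pi ^ 2) / (m₀ * preWienerMeasure.real (sleExitsTop 6 1)) +
      Real.pi ^ 2 / (m₀ * preWienerMeasure.real (sleExitsTop 6 1)) +
      1 / (m₀ * preWienerMeasure.real (sleExitsTop 6 1)) := by positivity
  set c : ℝ := ((1 + Real.pi ^ 2) / (m₀ * preWienerMeasure.real (sleExitsTop 6 1)) +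
      Real.pi ^ 2 / (m₀ * preWienerMeasure.real (sleExitsTop 6 1)) +
      1 / (m₀ * preWienerMeasure.real (sleExitsTop 6 1)))⁻¹ with hc_def
  have hc : 0 < c := inv_pos.2 hc₂0
  refine ⟨(c * Real.exp (-(5 / 48)))⁻¹, by positivity, fun R ν hR hν hle r hr0 hr12 ↦ ?_⟩
  have hA := (LawlerSchrammWerner2002_exp_bounds_oneSided h6 (hw ν).1 (hw ν).2).1 hm₀
    (by simpa using hlow R ν hR hν) hle
  rw [hlam] at hA
  have hlow' : ∀ t, 1 ≤ t → c * Real.exp (-(5 / 48 * t)) ≤ (ν : Measure (NonemptyCompacts ℂ)).real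
      {K | Literature.Analysis.Complex.conformalRadius (K : Set ℂ) ≤ Real.exp (-t)} := by
    intro t ht
    rw [hc_def, inv_mul_eq_div]
    exact hA t ht
  rw [inv_inv]
  exact measure_lower_of_exp_lower ν hlow' r hr0 hr12

/-- **The upper half of Theorem 1.2, uniformly at subsequential limits, from the Dini condition.**
There is `C > 0` such that for every weak limit `ν` of `lswLaw (R_k)`, `R_k → ∞`, IF for all
`t > 0`, `η > 0`, `δ > 0` some `θ ∈ (2π - δ, 2π)` has
`avg(avg w_ν)(t) - renewalST 6 V (avg(avg w_ν)) θ t < η (2π - θ)` (lower left Dini derivative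
`≤ 0` at `2π`; a consequence of LSW's (2.12)), then `ν{dist(0, K) ≤ r} ≤ C r^{5/48}` for
`r ∈ (0, 1/2)` (`LawlerSchrammWerner2002_exp_bounds_oneSided` (ii), `measure_upper_of_exp_upper`
with `koebeCovering_const`). No lower bound on `w_ν` is needed for this half.
[cite: LawlerSchrammWernerEJP2002, Thm. 1.2 (upper bound), Lemma 2.3] -/
theorem exists_measure_upper_of_renewal_dini :
    ∃ C : ℝ, 0 < C ∧ ∀ ν : ProbabilityMeasure (NonemptyCompacts ℂ),
      (∀ t, 0 < t → ∀ η, 0 < η → ∀ δ, 0 < δ → ∃ θ ∈ Ioo (2 * Real.pi - δ) (2 * Real.pi),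
        dataU (fun s ↦ (ν : Measure (NonemptyCompacts ℂ)).real
            {K | Literature.Analysis.Complex.conformalRadius (K : Set ℂ) ≤ Real.exp (-s)}) t -
          renewalST 6 dataV (dataU fun s ↦ (ν : Measure (NonemptyCompacts ℂ)).real
            {K | Literature.Analysis.Complex.conformalRadius (K : Set ℂ) ≤ Real.exp (-s)}) θ t <
          η * (2 * Real.pi - θ)) →
      ∀ r : ℝ, 0 < r → r < 1 / 2 →
        (ν : Measure (NonemptyCompacts ℂ)).real (meetsClosedBall r) ≤ C * r ^ (5 / 48 : ℝ) := by
  have h6 : (4 : ℝ≥0) < 6 := by norm_num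
  have hlam : lswLambda ((6 : ℝ≥0) : ℝ) = 5 / 48 := by
    rw [show ((6 : ℝ≥0) : ℝ) = 6 by norm_num]; exact lswLambda_six
  have hw : ∀ ν : ProbabilityMeasure (NonemptyCompacts ℂ),
      Antitone (fun s ↦ (ν : Measure (NonemptyCompacts ℂ)).real
        {K | Literature.Analysis.Complex.conformalRadius (K : Set ℂ) ≤ Real.exp (-s)}) ∧
      ∀ s, (ν : Measure (NonemptyCompacts ℂ)).real
        {K | Literature.Analysis.Complex.conformalRadius (K : Set ℂ) ≤ Real.exp (-s)} ∈ Icc (0 : ℝ) 1 := by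
    intro ν
    refine ⟨fun a b hab ↦ measureReal_mono (fun K hK ↦ ?_) (measure_ne_top _ _),
      fun s ↦ ⟨measureReal_nonneg, measureReal_le_one⟩⟩
    have hK' : Literature.Analysis.Complex.conformalRadius (K : Set ℂ) ≤ Real.exp (-b) := hK
    show Literature.Analysis.Complex.conformalRadius (K : Set ℂ) ≤ Real.exp (-a)
    exact hK'.trans (Real.exp_le_exp.2 (by linarith))
  have hπ := Real.pi_gt_three
  have hA0 : 0 < Real.sin (Real.pi / 4) ^ lswQ ((6 : ℝ≥0) : ℝ) * Real.exp (-(5 / 48 * 1)) :=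
    mul_pos (Real.rpow_pos_of_pos (sin_quarter_pos Real.pi_pos (by linarith)) _) (Real.exp_pos _)
  have hB0 : 0 < Real.sin (1 / 4) ^ lswQ ((6 : ℝ≥0) : ℝ) * Real.exp (-(5 / 48 * 0)) :=
    mul_pos (Real.rpow_pos_of_pos (sin_quarter_pos one_pos (by linarith)) _) (Real.exp_pos _)
  have hc₁0 : 0 < ((1 + Real.pi ^ 2) / (Real.sin (Real.pi / 4) ^ lswQ ((6 : ℝ≥0) : ℝ) * Real.exp (-(5 / 48 * 1))) +
      Real.pi ^ 2 / (Real.sin (1 / 4) ^ lswQ ((6 : ℝ≥0) : ℝ) * Real.exp (-(5 / 48 * 0)))) *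
      Real.exp (2 * (5 / 48)) :=
    mul_pos (add_pos (div_pos (by positivity) hA0) (div_pos (by positivity) hB0)) (Real.exp_pos _)
  obtain ⟨C, hC, hb⟩ := measure_upper_of_exp_upper koebeCovering_const (by positivity) hc₁0
  refine ⟨C, hC, fun ν hdini ↦ hb ν ?_⟩
  intro t ht
  have hA := (LawlerSchrammWerner2002_exp_bounds_oneSided h6 (hw ν).1 (hw ν).2).2 hdini
  rw [hlam] at hA
  refine (hA t ht).trans (le_of_eq ?_)
  rw [show -(5 / 48 * (t - 2)) = 2 * (5 / 48) + -(5 / 48 * t) by ring, Real.exp_add]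
  ring

/-! ### Theorem 1.2 and Theorem 1.1 from the two one-sided conditions -/

/-- **LSW Theorem 1.2 (`LawlerSchrammWerner2002_scalingLimitExponent`) from the two one-sided
conditions at `2π`.** If for every weak limit `ν` of `lswLaw R`, `R → ∞`, the renewal extension
of `avg(avg w_ν)` (i) stays below its boundary value `avg(avg w_ν)(t)` on `(0, 2π)` for `t > 0`
and (ii) satisfies the Dini condition at `2π` for `t > 0`, then Theorem 1.2 holds for every such
`ν`: (i) gives the lower bound `c⁻¹ r^{5/48} ≤ ν{dist(0, K) < r}`, (ii) the upper bound. This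
refines `LawlerSchrammWerner2002_scalingLimitExponent_of_neumannFlat` (Neumann flatness plus the
monotonicity implies both). [cite: LawlerSchrammWernerEJP2002, Thm. 1.2 (p. 2), Lemma 2.3] -/
theorem LawlerSchrammWerner2002_scalingLimitExponent_of_le_of_dini
    (hle : ∀ ν : ProbabilityMeasure (NonemptyCompacts ℂ), Tendsto lswLaw atTop (𝓝 ν) →
      ∀ t, 0 < t → ∀ θ ∈ Ioo 0 (2 * Real.pi), renewalST 6 dataV
          (dataU fun s ↦ (ν : Measure (NonemptyCompacts ℂ)).real
            {K | Literature.Analysis.Complex.conformalRadius (K : Set ℂ) ≤ Real.exp (-s)}) θ t ≤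
        dataU (fun s ↦ (ν : Measure (NonemptyCompacts ℂ)).real
            {K | Literature.Analysis.Complex.conformalRadius (K : Set ℂ) ≤ Real.exp (-s)}) t)
    (hdini : ∀ ν : ProbabilityMeasure (NonemptyCompacts ℂ), Tendsto lswLaw atTop (𝓝 ν) →
      ∀ t, 0 < t → ∀ η, 0 < η → ∀ δ, 0 < δ → ∃ θ ∈ Ioo (2 * Real.pi - δ) (2 * Real.pi),
        dataU (fun s ↦ (ν : Measure (NonemptyCompacts ℂ)).real
            {K | Literature.Analysis.Complex.conformalRadius (K : Set ℂ) ≤ Real.exp (-s)}) t -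
          renewalST 6 dataV (dataU fun s ↦ (ν : Measure (NonemptyCompacts ℂ)).real
            {K | Literature.Analysis.Complex.conformalRadius (K : Set ℂ) ≤ Real.exp (-s)}) θ t <
          η * (2 * Real.pi - θ)) :
    LawlerSchrammWerner2002_scalingLimitExponent := by
  obtain ⟨C₁, hC₁, hlow⟩ := exists_measure_lower_of_renewal_le
  obtain ⟨C₂, hC₂, hup⟩ := exists_measure_upper_of_renewal_dini
  intro ν hν
  have hν' : Tendsto (lswLaw ∘ fun k : ℕ ↦ (k : ℝ)) atTop (𝓝 ν) := hν.comp tendsto_natCast_atTop_atTop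
  refine ⟨max C₁ C₂, lt_max_of_lt_left hC₁, fun r hr0 hr12 ↦ ⟨?_, ?_⟩⟩
  · have h := hlow (fun k : ℕ ↦ (k : ℝ)) ν tendsto_natCast_atTop_atTop hν' (hle ν hν) r hr0 hr12
    refine le_trans ?_ h
    refine mul_le_mul_of_nonneg_right ?_ (Real.rpow_nonneg hr0.le _)
    exact inv_anti₀ hC₁ (le_max_left _ _)
  · have h := hup ν (hdini ν hν) r hr0 hr12
    refine (measureReal_mono (meetsBall_subset_meetsClosedBall r) (measure_ne_top _ _)).trans
      (h.trans ?_)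
    exact mul_le_mul_of_nonneg_right (le_max_right _ _) (Real.rpow_nonneg hr0.le _)

/-- **The one-arm exponent (LSW Theorem 1.1, `oneArm_exponent`) from the two one-sided conditions
at `2π`** at all subsequential weak limits of `lswLaw`: the lower measure bound from (i), the
upper from (ii) (constants uniform in `ν`), then LSW §3 as in `oneArm_exponent_of_neumannRenewal`
(`crossingBounds_of_subseqLimits`, `oneArm_exponent_of_crossingBounds`, RSW circuits). This
refines `oneArm_exponent_of_neumannFlat`. [cite: LawlerSchrammWernerEJP2002, Thm. 1.1, Thm. 1.2, §2–§3] -/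
theorem oneArm_exponent_of_le_of_dini
    (hle : ∀ (R : ℕ → ℝ) (ν : ProbabilityMeasure (NonemptyCompacts ℂ)),
      Tendsto R atTop atTop → Tendsto (lswLaw ∘ R) atTop (𝓝 ν) →
      ∀ t, 0 < t → ∀ θ ∈ Ioo 0 (2 * Real.pi), renewalST 6 dataV
          (dataU fun s ↦ (ν : Measure (NonemptyCompacts ℂ)).real
            {K | Literature.Analysis.Complex.conformalRadius (K : Set ℂ) ≤ Real.exp (-s)}) θ t ≤
        dataU (fun s ↦ (ν : Measure (NonemptyCompacts ℂ)).real
            {K | Literature.Analysis.Complex.conformalRadius (K : Set ℂ) ≤ Real.exp (-s)}) t)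
    (hdini : ∀ (R : ℕ → ℝ) (ν : ProbabilityMeasure (NonemptyCompacts ℂ)),
      Tendsto R atTop atTop → Tendsto (lswLaw ∘ R) atTop (𝓝 ν) →
      ∀ t, 0 < t → ∀ η, 0 < η → ∀ δ, 0 < δ → ∃ θ ∈ Ioo (2 * Real.pi - δ) (2 * Real.pi),
        dataU (fun s ↦ (ν : Measure (NonemptyCompacts ℂ)).real
            {K | Literature.Analysis.Complex.conformalRadius (K : Set ℂ) ≤ Real.exp (-s)}) t -
          renewalST 6 dataV (dataU fun s ↦ (ν : Measure (NonemptyCompacts ℂ)).real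
            {K | Literature.Analysis.Complex.conformalRadius (K : Set ℂ) ≤ Real.exp (-s)}) θ t <
          η * (2 * Real.pi - θ)) :
    oneArm_exponent := by
  obtain ⟨C₁, hC₁, hlow⟩ := exists_measure_lower_of_renewal_le
  obtain ⟨C₂, hC₂, hup⟩ := exists_measure_upper_of_renewal_dini
  set C := max C₁ C₂ with hC_def
  have hC : 0 < C := lt_max_of_lt_left hC₁
  have hlim : ∀ (R : ℕ → ℝ) (ν : ProbabilityMeasure (NonemptyCompacts ℂ)),
      Tendsto R atTop atTop → Tendsto (lswLaw ∘ R) atTop (𝓝 ν) →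
        ∀ r : ℝ, 0 < r → r < 1 / 2 →
          C⁻¹ * r ^ (5 / 48 : ℝ) ≤ (ν : Measure (NonemptyCompacts ℂ)).real (meetsBall r) ∧
            (ν : Measure (NonemptyCompacts ℂ)).real (meetsClosedBall r) ≤ C * r ^ (5 / 48 : ℝ) := by
    intro R ν hR hν r hr0 hr12
    constructor
    · refine le_trans ?_ (hlow R ν hR hν (hle R ν hR hν) r hr0 hr12)
      exact mul_le_mul_of_nonneg_right (inv_anti₀ hC₁ (le_max_left _ _)) (Real.rpow_nonneg hr0.le _)
    · refine (hup ν (hdini R ν hR hν) r hr0 hr12).trans ?_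
      exact mul_le_mul_of_nonneg_right (le_max_right _ _) (Real.rpow_nonneg hr0.le _)
  have hCinv2 : 0 < C⁻¹ / 2 := by positivity
  refine oneArm_exponent_of_crossingBounds ⟨fun r => C⁻¹ / 2 * r ^ (5 / 48 : ℝ),
    tendsto_log_const_mul_rpow_div_log hCinv2, fun r hr0 hr2 => ⟨by positivity, ?_⟩⟩
    ⟨fun r => 2 * C * r ^ (5 / 48 : ℝ), tendsto_log_const_mul_rpow_div_log (by positivity),
    fun r hr0 hr2 => ?_⟩ BollobasRiordan2006_openCircuit_holds
  · obtain ⟨s₀, hs₀⟩ := crossingBounds_of_subseqLimits hC hlim hr0 hr2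
    refine ⟨s₀, fun R hR => ?_⟩
    have h1 := (hs₀ R hR).1
    have e : C⁻¹ / 2 * r ^ (5 / 48 : ℝ) = C⁻¹ * r ^ (5 / 48 : ℝ) / 2 := by ring
    show C⁻¹ / 2 * r ^ (5 / 48 : ℝ) ≤ _
    rwa [e]
  · obtain ⟨s₀, hs₀⟩ := crossingBounds_of_subseqLimits hC hlim hr0 hr2
    refine ⟨s₀, fun R hR => ?_⟩
    have h2 := (hs₀ R hR).2
    show _ ≤ 2 * C * r ^ (5 / 48 : ℝ)
    rwa [mul_assoc]

end Literature.Probability.Percolation
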